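import Mathlib

/-!
# Injective maps with Jacobian bounded below preserve infinite volume
(crux `LaminatedThreshold`, idea `horizon-shadowed-bag`)

A second GR-free engine for piece (s3c) `NoFlatChartInLateBag` of
`Cruxes/LaminatedThreshold/Ideas/horizon-shadowed-bag.md` (round 2; passed triage,
`TRIAGE-r2-2.md`), complementing `LaminatedThresholdTranslateCoincidence.lean`. The 1+1 toy
of the card (Cheapest falsifier (2)) is NOT settled by one slice alone: a slice `ln T = h χ̃`
with `h (· + ℓ) < h` everywhere (a monotone spiral accumulating on a circle from above) IS
injectively projected to the strip `χ ∼ χ + ℓ` (triage evidence (3): "monotone spirals are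
injective"). What kills it is the NEXT slab: the unit-lapse image of `{σ < x⁰ < σ + 1, x¹ > x₀}`
has infinite area `≈ (1 ± ε) · ∞` in the chart, is mapped injectively with Jacobian `≈ 1`, and
is squeezed into the bounded-`T` collar above the accumulation circle, which has finite area.
The measure-theoretic half of that argument is the statement below: an injective map,
differentiable on a measurable set `s` of infinite Haar measure with `|det f'| ≥ c > 0` there,
has an image of infinite measure (`measure_image_eq_top_of_le_abs_det`), hence is contained in
no set of finite measure (`not_image_subset_of_measure_lt_top`). It is a one-step consequence of
Mathlib's change-of-variables inequality `lintegral_abs_det_fderiv_le_addHaar_image`; the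
geometric half (the image of the half-strip stays at bounded cosmological time) belongs to the
line that registers the toy.
-/

set_option linter.dupNamespace false

namespace Summit.FinalStateConjecture.FinalStateConjecture.Theorems.LaminatedThreshold.HorizonShadowedBag

open Set MeasureTheory

/-- **Injective maps with Jacobian bounded below preserve infinite volume.** If `f` is injective
on a measurable set `s` of infinite (additive Haar) measure, differentiable within `s` with
`c ≤ |det f' x|` for some `c > 0`, then `f '' s` has infinite measure. [folklore; from Mathlib's
`lintegral_abs_det_fderiv_le_addHaar_image`] -/
theorem measure_image_eq_top_of_le_abs_det : ∀ {E : Type} [NormedAddCommGroup E] [NormedSpace ℝ E] [FiniteDimensional ℝ E] [MeasurableSpace E] [BorelSpace E] (μ : MeasureTheory.Measure E) [μ.IsAddHaarMeasure] (f : E → E) (f' : E → E →L[ℝ] E) (s : Set E) (c : ℝ), MeasurableSet s → (∀ x ∈ s, HasFDerivWithinAt f (f' x) s x) → Set.InjOn f s → 0 < c → (∀ x ∈ s, c ≤ |(f' x).det|) → μ s = ⊤ → μ (f '' s) = ⊤ := by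
  intro E _ _ _ _ _ μ _ f f' s c hs hf' hf hc hdet hμ
  have h := lintegral_abs_det_fderiv_le_addHaar_image μ hs hf' hf
  have h2 : ∫⁻ _ in s, ENNReal.ofReal c ∂μ ≤ ∫⁻ x in s, ENNReal.ofReal |(f' x).det| ∂μ :=
    setLIntegral_mono' hs fun x hx ↦ ENNReal.ofReal_le_ofReal (hdet x hx)
  rw [setLIntegral_const, hμ, ENNReal.mul_top (ENNReal.ofReal_ne_zero_iff.2 hc)] at h2
  exact top_unique (h2.trans h)

/-- Corollary: under the same hypotheses `f '' s` is contained in no set of finite measure (the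
form used by the 1+1 toy: the image of an infinite-area half-strip does not fit into a
bounded-`T` collar of the strip `χ ∼ χ + ℓ`). [folklore] -/
theorem not_image_subset_of_measure_lt_top {E : Type} [NormedAddCommGroup E] [NormedSpace ℝ E]
    [FiniteDimensional ℝ E] [MeasurableSpace E] [BorelSpace E] (μ : MeasureTheory.Measure E)
    [μ.IsAddHaarMeasure] {f : E → E} {f' : E → E →L[ℝ] E} {s t : Set E} {c : ℝ}
    (hs : MeasurableSet s) (hf' : ∀ x ∈ s, HasFDerivWithinAt f (f' x) s x) (hf : Set.InjOn f s)
    (hc : 0 < c) (hdet : ∀ x ∈ s, c ≤ |(f' x).det|) (hμ : μ s = ⊤) (ht : μ t < ⊤) :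
    ¬ f '' s ⊆ t := fun hsub ↦
  (lt_top_iff_ne_top.1 (lt_of_le_of_lt (measure_mono hsub) ht))
    (measure_image_eq_top_of_le_abs_det μ f f' s c hs hf' hf hc hdet hμ)

end Summit.FinalStateConjecture.FinalStateConjecture.Theorems.LaminatedThreshold.HorizonShadowedBag
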